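import Literature.NumberTheory.EllipticCurves.CongruentNumberCurveJacobiSums
import Literature.NumberTheory.GaloisRepresentations.QuarticResidueSymbol
import Mathlib.NumberTheory.NumberField.Cyclotomic.Basic
import HarnessLib

/-!
# `ℤ[i] = 𝓞 ℚ(i)`: the bridge between the `GaussianInt` currency and the `𝓞 K` currency of the quartic residue
# symbol (Ireland–Rosen, Ch. 1 §4 / Ch. 9 §7: `D = ℤ[i]` is the ring of integers of `ℚ(i)`; Ch. 9 §8 Definition of `χ_π`)

The tree holds the arithmetic of `ℤ[i]` twice: in Mathlib's `GaussianInt = ℤ√-1` (stories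
`QuadraticFields/GaussianPrimary`, `EllipticCurves/CongruentNumberCurveJacobiSums` — the quartic residue character
`GaussianQuartic.chi hp1 hπp : MulChar (ZMod p) ℤ[i]` of a Gaussian prime `π` of norm `p ≡ 1 (mod 4)` with the reduction
`GaussianQuartic.red hπp : ℤ[i] →+* ZMod p` — and `QuadraticFields/GaussianQuarticReciprocity{,Split}`), and in the
`𝓞 K` currency of a number field `K` with a primitive fourth root of unity `ζ ∈ 𝓞 K` (`IsCyclotomicExtension {4} ℚ K`):
`GaloisRepresentations/QuarticResidueSymbol` (`quarticResidueSymbol 𝔭 : 𝓞 K ⧸ 𝔭 → 𝓞 K`), `…/BiquadraticReciprocity*`,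
`…/QuarticTwistHeckeCharacter`, …  This file is the dictionary between the two (theorems only; no definition, no named
fact):

* `exists_ringEquiv_apply_eq` — for `K/ℚ` cyclotomic of conductor `4` and `hζ : IsPrimitiveRoot ζ 4` in `𝓞 K`, there is a
  ring isomorphism `e : GaussianInt ≃+* 𝓞 K` with `e i = ζ` (hence `e (a + bi) = a + bζ`, `ringHom_apply_eq`): injective by
  `Zsqrtd.lift_injective`, surjective because `𝓞 K = ℤ[ζ]` (Mathlib's `IsCyclotomicExtension.Rat.adjoin_singleton_eq_top`).
* `map_chi_red_eq_quarticResidueSymbol` — under any such `e`, for a Gaussian prime `π` of norm `p ≡ 1 (mod 4)` and the place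
  `𝔭 = (e π)` of `K`: `e (χ_π(α)) = quarticResidueSymbol 𝔭 (e α mod 𝔭)` for every `α ∈ ℤ[i]`, where on the left
  `χ_π(α) := GaussianQuartic.chi hp1 hπp (GaussianQuartic.red hπp α)`.  Both sides are THE fourth root of unity congruent to
  `α^{(p-1)/4}` modulo `π` (Ireland–Rosen's Definition), compared through the residue-field isomorphism
  `𝓞 K ⧸ 𝔭 ≃ ℤ[i] ⧸ π ≃ 𝔽_p` (`exists_ringHom_quotient`, `absNorm_span_map_eq`: `N𝔭 = p`).

## References

* K. Ireland, M. Rosen, *A Classical Introduction to Modern Number Theory*, 2nd ed., GTM 84 (1990), Ch. 9 §7 (the ring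
  `D = ℤ[i]`), §8 Definition of the quartic residue character after Prop. 9.8.2 (PDF pp. 128–129); Ch. 13 §1 Prop. 13.1.1
  (integers of quadratic fields, `d = -1`). [cite: IrelandRosen1990]
-/

noncomputable section

open scoped Classical NumberField

namespace Literature.NumberTheory.QuadraticFields

namespace GaussianIntRingOfIntegers

open Zsqrtd NumberField IsDedekindDomain Literature.NumberTheory.EllipticCurves.GaussianQuartic
  Literature.NumberTheory.GaloisRepresentations

variable {K : Type*} [Field K] [NumberField K]

/-! ### Ring maps out of `ℤ[i]` -/

/-- A ring map `f : ℤ[i] → R` is `f(a + bi) = a + b·f(i)`. [cite: IrelandRosen1990, Ch. 9 §7 (the ring `D = ℤ[i]`)] -/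
theorem ringHom_apply_eq {R : Type*} [CommRing R] (f : GaussianInt →+* R) (z : GaussianInt) :
    f z = (z.re : R) + (z.im : R) * f ⟨0, 1⟩ := by
  have hz : z = (z.re : GaussianInt) + (z.im : GaussianInt) * ⟨0, 1⟩ := by ext <;> simp
  conv_lhs => rw [hz]
  rw [map_add, map_mul, map_intCast, map_intCast]

/-- `ζ² = -1` for a primitive fourth root of unity in a domain. [folklore] -/
private theorem sq_eq_neg_one {R : Type*} [CommRing R] [IsDomain R] {ζ : R} (hζ : IsPrimitiveRoot ζ 4) :
    ζ * ζ = -1 := by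
  rw [← sq]
  exact (hζ.pow (by norm_num) (show 4 = 2 * 2 by norm_num)).eq_neg_one_of_two_right

/-- **`ℤ[i] ≅ 𝓞 ℚ(i)`**: for a cyclotomic field `K` of conductor `4` and a primitive fourth root of unity `ζ ∈ 𝓞 K` there is
a ring isomorphism `e : GaussianInt ≃+* 𝓞 K` with `e(i) = ζ` — `i ↦ ζ` is injective (`-1` is not a square in `ℤ`) and onto
because `𝓞 K = ℤ[ζ]` (Ireland–Rosen Ch. 13 §1 Prop. 13.1.1 at `d = -1`; Mathlib `IsCyclotomicExtension.Rat.adjoin_singleton_eq_top`).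
[cite: IrelandRosen1990, Ch. 13 §1, Prop. 13.1.1 (d = -1) and Ch. 9 §7] -/
theorem exists_ringEquiv_apply_eq [IsCyclotomicExtension {4} ℚ K] {ζ : 𝓞 K} (hζ : IsPrimitiveRoot ζ 4) :
    ∃ e : GaussianInt ≃+* 𝓞 K, e ⟨0, 1⟩ = ζ := by
  have hζ2 : ζ * ζ = ((-1 : ℤ) : 𝓞 K) := by rw [sq_eq_neg_one hζ]; simp
  let f : GaussianInt →+* 𝓞 K := Zsqrtd.lift ⟨ζ, hζ2⟩
  have hfI : f ⟨0, 1⟩ = ζ := by simp [f]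
  have hinj : Function.Injective f :=
    Zsqrtd.lift_injective _ (fun n h ↦ by nlinarith [mul_self_nonneg n])
  -- surjective: `𝓞 K = ℤ[ζ]`
  have hζK : IsPrimitiveRoot (ζ : K) 4 := hζ.map_of_injective RingOfIntegers.coe_injective
  have htop : Algebra.adjoin ℤ ({ζ} : Set (𝓞 K)) = ⊤ := by
    have h := IsCyclotomicExtension.Rat.adjoin_singleton_eq_top hζK
    rwa [IsPrimitiveRoot.toInteger_coe hζK] at h
  have hsurj : Function.Surjective f := by
    intro y
    have hy : y ∈ Algebra.adjoin ℤ ({ζ} : Set (𝓞 K)) := by rw [htop]; exact Algebra.mem_top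
    rw [Algebra.adjoin_singleton_eq_range_aeval] at hy
    obtain ⟨q, rfl⟩ := hy
    refine ⟨Polynomial.aeval (⟨0, 1⟩ : GaussianInt) q, ?_⟩
    change f.toIntAlgHom (Polynomial.aeval (⟨0, 1⟩ : GaussianInt) q) = _
    rw [← Polynomial.aeval_algHom_apply, RingHom.toIntAlgHom_apply, hfI]
    rfl
  exact ⟨RingEquiv.ofBijective f ⟨hinj, hsurj⟩, hfI⟩

/-! ### The residue field at a Gaussian prime of degree one, in both currencies -/

section Residue

variable {p : ℕ} [hp : Fact p.Prime] {π : GaussianInt}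

/-- `φ_π : ℤ[i] → 𝔽_p` is onto. [folklore] -/
private theorem red_surjective (hπp : π.norm = p) : Function.Surjective (red hπp) :=
  ZMod.ringHom_surjective _

/-- The kernel of `φ_π : ℤ[i] → 𝔽_p` is `(π)`. [folklore] -/
private theorem ker_red (hπp : π.norm = p) : RingHom.ker (red hπp) = Ideal.span {π} := by
  ext x
  rw [RingHom.mem_ker, Ideal.mem_span_singleton]
  refine ⟨dvd_of_red_eq_zero hπp, fun ⟨c, hc⟩ ↦ ?_⟩
  rw [hc, map_mul, red_self, zero_mul]

omit [NumberField K] in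
/-- **The residue fields agree**: for `e : ℤ[i] ≃ 𝓞 K`, a Gaussian prime `π` of norm `p` and the ideal `𝔓 = (e π)`, there is a
ring map `φ : 𝓞 K ⧸ 𝔓 →+* 𝔽_p`, injective and with `φ(e α mod 𝔓) = φ_π(α)` — i.e. `𝓞 K ⧸ (eπ) ≅ ℤ[i]/π ≅ 𝔽_p`
(Ireland–Rosen, Prop. 9.8.1: «`D/πD` is a finite field with `N(π)` elements»). [cite: IrelandRosen1990, Ch. 9 §8, Prop. 9.8.1 (PDF p. 128)] -/
theorem exists_ringHom_quotient (e : GaussianInt ≃+* 𝓞 K) (hπp : π.norm = p) {𝔓 : Ideal (𝓞 K)}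
    (h𝔓 : 𝔓 = Ideal.span {e π}) :
    ∃ φ : 𝓞 K ⧸ 𝔓 →+* ZMod p, Function.Injective φ ∧ Function.Surjective φ ∧
      ∀ α : GaussianInt, φ (Ideal.Quotient.mk 𝔓 (e α)) = red hπp α := by
  let ψ : 𝓞 K →+* ZMod p := (red hπp).comp (e.symm : 𝓞 K →+* GaussianInt)
  have hψ : ∀ α : GaussianInt, ψ (e α) = red hπp α := fun α ↦ by
    change red hπp (e.symm (e α)) = red hπp α
    rw [RingEquiv.symm_apply_apply]
  have hker : RingHom.ker ψ = 𝔓 := by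
    ext a
    rw [RingHom.mem_ker, h𝔓, Ideal.mem_span_singleton]
    change red hπp (e.symm a) = 0 ↔ _
    rw [← RingHom.mem_ker, ker_red hπp, Ideal.mem_span_singleton]
    constructor
    · rintro ⟨c, hc⟩
      refine ⟨e c, ?_⟩
      rw [← map_mul, ← hc, RingEquiv.apply_symm_apply]
    · rintro ⟨c, hc⟩
      refine ⟨e.symm c, ?_⟩
      rw [hc, map_mul, RingEquiv.symm_apply_apply]
  have hle : ∀ a ∈ 𝔓, ψ a = 0 := fun a ha ↦ by rw [← RingHom.mem_ker, hker]; exact ha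
  refine ⟨Ideal.Quotient.lift 𝔓 ψ hle, ?_, ?_, fun α ↦ by rw [Ideal.Quotient.lift_mk]; exact hψ α⟩
  · rw [RingHom.injective_iff_ker_eq_bot, RingHom.ker_eq_bot_iff_eq_zero]
    intro x hx
    obtain ⟨a, rfl⟩ := Ideal.Quotient.mk_surjective x
    rw [Ideal.Quotient.lift_mk] at hx
    exact Ideal.Quotient.eq_zero_iff_mem.mpr (hker ▸ hx)
  · intro t
    obtain ⟨α, hα⟩ := red_surjective hπp t
    exact ⟨Ideal.Quotient.mk 𝔓 (e α), by rw [Ideal.Quotient.lift_mk, hψ, hα]⟩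

/-- `N((e π)) = p`: the absolute norm of the ideal generated by the image of a Gaussian prime of norm `p` is `p`
(`#(𝓞 K ⧸ (eπ)) = #𝔽_p`). [cite: IrelandRosen1990, Ch. 9 §8, Prop. 9.8.1 (PDF p. 128)] -/
theorem absNorm_span_map_eq (e : GaussianInt ≃+* 𝓞 K) (hπp : π.norm = p) :
    Ideal.absNorm (Ideal.span {e π} : Ideal (𝓞 K)) = p := by
  obtain ⟨φ, hinj, hsurj, -⟩ := exists_ringHom_quotient e hπp rfl
  rw [Ideal.absNorm_apply, Submodule.cardQuot_apply, Nat.card_congr (Equiv.ofBijective φ ⟨hinj, hsurj⟩),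
    Nat.card_zmod]

end Residue

/-! ### The two quartic residue symbols agree -/

section Compare

variable {p : ℕ} [hp : Fact p.Prime] {π : GaussianInt}

/-- **One symbol, two currencies.** Let `e : ℤ[i] ≃ 𝓞 K` be any ring isomorphism (`K ∋ ζ`, a primitive fourth root of
unity in `𝓞 K`, e.g. `e(i) = ζ`), `π` a Gaussian prime of norm `p ≡ 1 (mod 4)`, and `𝔭` the place of `K` with `𝔭 = (e π)`.  Then for every `α ∈ ℤ[i]`,
`e (χ_π(α)) = quarticResidueSymbol 𝔭 (e α mod 𝔭)`, where `χ_π(α) = GaussianQuartic.chi hp1 hπp (GaussianQuartic.red hπp α)`: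
both are `0` if `π ∣ α`, and otherwise THE fourth root of unity congruent to `α^{(N(π)-1)/4}` modulo `π`
(Ireland–Rosen's Definition; `GaussianQuartic.chi_eq_iff` and `quarticResidueSymbol_eq_iff`), the congruences being
compared in `𝔽_p` through `exists_ringHom_quotient`. [cite: IrelandRosen1990, Ch. 9 §8, Definition after Prop. 9.8.2 (PDF p. 129)] -/
theorem map_chi_red_eq_quarticResidueSymbol {ζ : 𝓞 K} (hζ : IsPrimitiveRoot ζ 4) (e : GaussianInt ≃+* 𝓞 K)
    (hp1 : p % 4 = 1) (hπp : π.norm = p) (𝔭 : HeightOneSpectrum (𝓞 K))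
    (h𝔭 : 𝔭.asIdeal = Ideal.span {e π}) (α : GaussianInt) :
    e (chi hp1 hπp (red hπp α)) = quarticResidueSymbol 𝔭 (Ideal.Quotient.mk 𝔭.asIdeal (e α)) := by
  obtain ⟨φ, hinj, -, hφ⟩ := exists_ringHom_quotient e hπp h𝔭
  have hcard : 𝔭.residueCard = p := by
    change Ideal.absNorm 𝔭.asIdeal = p
    rw [h𝔭, absNorm_span_map_eq e hπp]
  have h5 := five_le hp1
  -- `𝔭 ∤ 2`
  have h2 : (2 : 𝓞 K) ∉ 𝔭.asIdeal := by
    intro h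
    have h0 : φ (Ideal.Quotient.mk 𝔭.asIdeal (e 2)) = 0 := by
      rw [map_ofNat, Ideal.Quotient.eq_zero_iff_mem.mpr h, map_zero]
    rw [hφ, map_ofNat] at h0
    have : ((2 : ℕ) : ZMod p) = 0 := by exact_mod_cast h0
    rw [ZMod.natCast_eq_zero_iff] at this
    have := Nat.le_of_dvd two_pos this
    omega
  rcases eq_or_ne (red hπp α) 0 with h0 | h0
  · -- `π ∣ α`: both sides vanish
    have hmk : Ideal.Quotient.mk 𝔭.asIdeal (e α) = 0 := by
      apply hinj
      rw [hφ, h0, map_zero]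
    rw [h0, MulChar.map_zero, map_zero, hmk, quarticResidueSymbol_zero hζ]
  · have hmk : Ideal.Quotient.mk 𝔭.asIdeal (e α) ≠ 0 := fun h ↦ h0 (by rw [← hφ, h, map_zero])
    symm
    refine (quarticResidueSymbol_eq_iff hζ h2 hmk).mpr ⟨?_, ?_⟩
    · rw [← map_pow, chi_pow_four hp1 hπp h0, map_one]
    · apply hinj
      rw [hφ, map_pow, hφ, hcard, red_chi hp1 hπp h0]
      congr 1
      omega

omit [NumberField K] in
/-- The same with `𝔭` CHOSEN: the place of `K` under `e π` exists (`(e π)` is a nonzero prime ideal, `N = p`), so every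
degree-one Gaussian prime has a matching height-one prime of `𝓞 K` at which the two symbols agree. [cite: IrelandRosen1990, Ch. 9 §8, Prop. 9.8.1 and Definition after Prop. 9.8.2 (PDF pp. 128–129)] -/
theorem exists_heightOneSpectrum_span_map (e : GaussianInt ≃+* 𝓞 K) (hπp : π.norm = p) :
    ∃ 𝔭 : HeightOneSpectrum (𝓞 K), 𝔭.asIdeal = Ideal.span {e π} := by
  obtain ⟨φ, hinj, -, -⟩ := exists_ringHom_quotient e hπp (rfl : (Ideal.span {e π} : Ideal (𝓞 K)) = _)
  haveI : IsDomain (𝓞 K ⧸ (Ideal.span {e π} : Ideal (𝓞 K))) := hinj.isDomain φ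
  have hprime : (Ideal.span {e π} : Ideal (𝓞 K)).IsPrime := (Ideal.Quotient.isDomain_iff_prime _).mp inferInstance
  have hne : (Ideal.span {e π} : Ideal (𝓞 K)) ≠ ⊥ := by
    intro h
    rw [Ideal.span_singleton_eq_bot, EmbeddingLike.map_eq_zero_iff] at h
    rw [h, Zsqrtd.norm_zero] at hπp
    exact hp.out.ne_zero (by exact_mod_cast hπp.symm)
  exact ⟨⟨Ideal.span {e π}, hprime, hne⟩, rfl⟩

end Compare

end GaussianIntRingOfIntegers

end Literature.NumberTheory.QuadraticFields

end
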